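import Literature.AlgebraicGeometry.ShimuraVarieties.UnitaryShimuraCurvePiecesComparison
import HarnessLib

/-!
# The identification `(M_K ⊗_L E′) ≅ X` over `E′` of a canonical-model record of the unitary Shimura CURVE with ANY weak model `X` over
# `E′ ⊇ L` presented by points, disc-quotient pieces and weak reciprocity — ONE head assembling ★ BC → ★ PIECES → ★ UNIQ-WEAK
# ([Deligne 1979] 2.2.6; [Milne 2005] Thm. 13.6–13.7; the GEN identification step of the P6a letter `stub_RGD`)

Topic `AlgebraicGeometry/ShimuraVarieties`, namespace `…ShimuraVarieties.UnitaryCanonicalModel`.  THEOREMS ONLY (no definition, no instance, no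
notation, no named fact, no `sorry`).  Cell `hodgecm-mathlib` (D-0151), programme P6 «MOD» (crux hLiu418 = stmt-HodgeConjecture-24832, `--supports`).
The chain: ★ `RecordSystemGS.exists_weakRecord_baseChange` (p845986: `Y := (S.M K) ⊗_L E′` is a weak record, bridge `gY`) → ★
`RecordSystemGS.exists_complexIso_weak` (p846073: `gc : Y_ℂ ≅ X_ℂ` from pieces) → ★ `WeakRecordGS.exists_iso_of_complexIso` (p845822:
descent to `E′`).  What the moduli side (GEN `stub_UNIF`) owes is exactly the hypothesis list of the head: (F1) `X` smooth of relative
dimension 1 and projective over `E′`, (F2a) `ptsX : X_{τ′}(ℂ) ≃ₜ Sh_K(ℂ)`, (F2c) a pieces presentation of `X ⊗_{τ′} ℂ` read through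
`bce_{τ′} ∘ ptsX⁻¹`, (F3) weak reciprocity at the diagonal CM pairs for `Aut(ℂ∕τ′E′)`.  HONEST LABEL: HC_CM is proved only modulo the 2 remaining
named inputs (hLiu418 24832, h413 24833) until rung 0 closes; this file is count-neutral capital.

## References
* [Deligne1979ShimuraVarieties] P. Deligne, *Variétés de Shimura* (1979), 2.1.2–2.1.4, 2.2.4–2.2.6, 2.7.12.
* [Milne2005ShimuraVarieties] J. S. Milne, *Introduction to Shimura varieties* (2005), Prop. 13.1 p. 117, Lemma 13.5, Thm. 13.6 p. 118, Thm. 13.7 p. 119.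
-/

set_option autoImplicit false

noncomputable section

open Function MulAction Topology NumberField IsDedekindDomain CategoryTheory CategoryTheory.Limits Matrix
  AlgebraicGeometry
open scoped Matrix ComplexOrder
open Literature.AlgebraicGeometry.Motives Literature.NumberTheory.Automorphic Literature.NumberTheory.Automorphic.UnitaryGroup
open Literature.NumberTheory.Automorphic.Liu2021.AppendixC (C5.OpenCompactSubgroup C5.SmallLevel)
open Literature.NumberTheory.Automorphic.ShimuraDissection

namespace Literature.AlgebraicGeometry.ShimuraVarieties.UnitaryCanonicalModel

variable {L : Type} [Field L] [NumberField L] [IsCMField L] {Jstar : Matrix (Fin 2) (Fin 2) L} {τ : L →+* ℂ}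
  {K₀ : C5.OpenCompactSubgroup ↥(finAdelic (↥(maximalRealSubfield L)) L (IsCMField.complexConj L) 2 Jstar)} {E : Type} [Field E] [NumberField E] [Algebra L E] {τE : E →+* ℂ}

set_option maxHeartbeats 400000 in -- large adelic ∕ Shimura-set binder types (as the ★ files it assembles)
/-- **Identification of a curve record with a weak model over `E′ ⊇ L`** ([Deligne1979ShimuraVarieties] 2.2.6, [Milne2005ShimuraVarieties] Thm. 13.6–13.7,
PROVED): let `S : RecordSystemGS L J⋆ τ K₀` (`J⋆` hermitian non-degenerate), `E′` a number field with `L → E′` and `τ′ : E′ → ℂ` extending `τ`, `K` a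
small level, and `X` an `E′`-scheme, smooth of relative dimension `1` and projective, with (F2a) `ptsX : X_{τ′}(ℂ) ≃ₜ Sh_K(ℂ)`, (F2c) a pieces
presentation of `X ⊗_{τ′} ℂ` (disc quotients of the tree՚s kind with hermitian matrix `J⋆^τ`, groups `τ(Γ_{J⋆}(g_qKg_q⁻¹))`, uniformised by
`v ↦ bce(ptsX⁻¹[v, g_qK])`), and (F3) Shimura reciprocity at the diagonal CM pairs for every `σ ∈ Aut(ℂ∕τ′E′)`.  Then there is an
`E′`-ISOMORPHISM `φ : (S.M K) ⊗_L E′ ≅ X` carrying, on complex points along `τ′`, `ptsY⁻¹[v,aK] ↦ ptsX⁻¹[v,aK]` for a point bijection `ptsY` of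
`(S.M K) ⊗_L E′` which itself satisfies (F3) for `Aut(ℂ∕τ′E′)` — so `φ` is unique (★ `WeakRecordGS.hom_unique`) and Hecke-equivariant.  Assembly of ★
`RecordSystemGS.exists_weakRecord_baseChange` → ★ `RecordSystemGS.exists_complexIso_weak` → ★ `WeakRecordGS.exists_iso_of_complexIso`.
[cite: Deligne1979ShimuraVarieties, 2.2.6 and 2.7.12] [cite: Milne2005ShimuraVarieties, Thm. 13.6 p. 118 and Thm. 13.7 p. 119] -/
theorem RecordSystemGS.exists_iso_baseChange_weakModel (S : RecordSystemGS L Jstar τ K₀) (hJ : (Jstar.map (IsCMField.complexConj L))ᵀ = Jstar)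
    (hdet : IsUnit Jstar.det) (hτ : τE.comp (algebraMap L E) = τ) (K : C5.SmallLevel K₀)
    (X : SchemeOver E) [SmoothOfRelativeDimension 1 X.hom] (hX : IsProjectiveOver X)
    (ptsX : letI : Algebra E ℂ := τE.toAlgebra; ComplexPoints X ≃ₜ ShimuraSetGS L Jstar τ K.1.1)
    (piecesX : letI : Algebra E ℂ := τE.toAlgebra
      (∃ (g : orbitRel.Quotient ↥(rational (↥(maximalRealSubfield L)) L (IsCMField.complexConj L) 2 Jstar)
          (CosetSpace (rationalToFinAdelic (↥(maximalRealSubfield L)) L (IsCMField.complexConj L) 2 Jstar) K.1.1) → ↥(finAdelic (↥(maximalRealSubfield L)) L (IsCMField.complexConj L) 2 Jstar))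
      (_ : ∀ q, Quotient.mk'' (CosetSpace.pt (rationalToFinAdelic (↥(maximalRealSubfield L)) L (IsCMField.complexConj L) 2 Jstar) K.1.1 (g q)) = q)
      (Xp : orbitRel.Quotient ↥(rational (↥(maximalRealSubfield L)) L (IsCMField.complexConj L) 2 Jstar)
          (CosetSpace (rationalToFinAdelic (↥(maximalRealSubfield L)) L (IsCMField.complexConj L) 2 Jstar) K.1.1) → SchemeOver ℂ)
      (ι : ∀ q, Xp q ⟶ ((Motives.baseChangeHom τE).obj X))
      (_ : Limits.IsColimit (Limits.Cofan.mk ((Motives.baseChangeHom τE).obj X) ι))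
      (B : ∀ q, UnitaryBallUniformisationDatum 1 (Xp q)),
      ∀ q, (B q).Hℂ = Jstar.map τ ∧
        (B q).Γ.map (Matrix.GeneralLinearGroup.map ((B q).τ₁ : ↥(B q).E →+* ℂ)) =
          (arithmeticLevel (↥(maximalRealSubfield L)) L (IsCMField.complexConj L) 2 Jstar
            (K.1.1.map (MulAut.conj (g q)).toMonoidHom)).map (Matrix.GeneralLinearGroup.map τ) ∧
        ∀ (v : Fin 2 → ℂ) (hv : v ∈ negCone (Jstar.map τ)),
          AlgPoints.map (ι q) ((B q).unif v) = (fun m => AlgPoints.baseChangeEquiv τE X (ptsX.symm m)) (ShimuraSetGS.mk L Jstar τ K.1.1 v hv (g q))))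
    (recipX : letI : Algebra E ℂ := τE.toAlgebra
      ∀ (σ : ℂ ≃ₐ[E] ℂ) (s : (FiniteAdeleRing (𝓞 L) L)ˣ), IsArtinCorrespondent L τ s σ.toRingEquiv →
        ∀ (w : Fin 2 → L) (hw : (fun i => τ (w i)) ∈ negCone (Jstar.map τ)) (d : ↥(finAdelic (↥(maximalRealSubfield L)) L (IsCMField.complexConj L) 2 Jstar)),
          IsDiagTwistGS L Jstar w (recipFactor L s) d →
          ∀ a : ↥(finAdelic (↥(maximalRealSubfield L)) L (IsCMField.complexConj L) 2 Jstar), σ • ptsX.symm (ShimuraSetGS.mk L Jstar τ K.1.1 (fun i => τ (w i)) hw a) =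
            ptsX.symm (ShimuraSetGS.mk L Jstar τ K.1.1 (fun i => τ (w i)) hw (d * a))) :
    letI : Algebra E ℂ := τE.toAlgebra
    ∃ (ptsY : ComplexPoints ((Motives.baseChange L E).obj (S.M.obj K)) ≃ₜ ShimuraSetGS L Jstar τ K.1.1)
      (φ : (Motives.baseChange L E).obj (S.M.obj K) ≅ X),
      (∀ (σ : ℂ ≃ₐ[E] ℂ) (s : (FiniteAdeleRing (𝓞 L) L)ˣ), IsArtinCorrespondent L τ s σ.toRingEquiv →
        ∀ (w : Fin 2 → L) (hw : (fun i => τ (w i)) ∈ negCone (Jstar.map τ)) (d : ↥(finAdelic (↥(maximalRealSubfield L)) L (IsCMField.complexConj L) 2 Jstar)),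
          IsDiagTwistGS L Jstar w (recipFactor L s) d →
          ∀ a : ↥(finAdelic (↥(maximalRealSubfield L)) L (IsCMField.complexConj L) 2 Jstar), σ • ptsY.symm (ShimuraSetGS.mk L Jstar τ K.1.1 (fun i => τ (w i)) hw a) =
            ptsY.symm (ShimuraSetGS.mk L Jstar τ K.1.1 (fun i => τ (w i)) hw (d * a))) ∧
      ∀ (v : Fin 2 → ℂ) (hv : v ∈ negCone (Jstar.map τ)) (a : ↥(finAdelic (↥(maximalRealSubfield L)) L (IsCMField.complexConj L) 2 Jstar)),
        ptsX (AlgPoints.map φ.hom (ptsY.symm (ShimuraSetGS.mk L Jstar τ K.1.1 v hv a))) = ShimuraSetGS.mk L Jstar τ K.1.1 v hv a := by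
  letI iE : Algebra E ℂ := τE.toAlgebra
  letI iL : Algebra L ℂ := τ.toAlgebra
  -- `Y := (S.M K) ⊗_L E′` is smooth of relative dimension 1 and projective
  haveI : SmoothOfRelativeDimension 1 (S.M.obj K).hom := S.smooth K
  haveI hYs : SmoothOfRelativeDimension 1 ((Motives.baseChange L E).obj (S.M.obj K)).hom :=
    HodgeTheory.smoothOfRelativeDimension_baseChangeHom_hom (algebraMap L E) 1 (S.M.obj K)
  have hY : IsProjectiveOver ((Motives.baseChange L E).obj (S.M.obj K)) := (S.projective K).baseChange_obj E
  -- BC: the weak record structure of `Y` and the bridge to `S`՚s complex fibre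
  obtain ⟨ptsY, recipY, gY, hgY⟩ := S.exists_weakRecord_baseChange hτ K
  -- PIECES: the complex comparison isomorphism `gc : Y_ℂ ≅ X_ℂ`
  obtain ⟨gc, hgc⟩ := S.exists_complexIso_weak K X hX ptsX piecesX ptsY gY hgY
  -- UNIQ-WEAK: descent to `E′`
  obtain ⟨φ, hφ⟩ := WeakRecordGS.exists_iso_of_complexIso hτ K.1.1 X ((Motives.baseChange L E).obj (S.M.obj K)) hX hY
    ptsX ptsY recipX recipY gc hgc hJ hdet
  exact ⟨ptsY, φ, recipY, hφ⟩

end Literature.AlgebraicGeometry.ShimuraVarieties.UnitaryCanonicalModel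

end
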